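import Literature.AnabelianGeometry.EtaleTheta.Discharge.Sec4NonVacuityTowerConj
import HarnessLib

/-!
# [EtTh] §4 over the GENUINE Kummer tower: Thm 4.4 (i)–(iv) FIRE for the conjugation-type self-equivalence
# `(Ψ, Ψ^bs) = (conjEquiv, negBaseEquiv)` — `Ψ^bs` NON-TRIVIAL, `Aut_{D}(A^bs) ≅ Aut_{D}(Ψ(A)^bs)` = NEGATION on `ℤ/N`
# (consistency witness, part 13b — conclusion)

S. Mochizuki, *The étale theta function and its Frobenioid-theoretic manifestations*, Publ. RIMS **45**
(2009) [MochizukiEtTh2009], §4, Thm 4.4 (i)–(iv) pp.93–95 (PDF); sub-DAG `plan/L2/SUBDAG-EtTh-Thm44.md` (T44-L03,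
T44-L09/L09c, T44-L10, T44-L12, T44-L15b).

CONSISTENCY WITNESS, TOY — PROOF-ONLY (no definition, no named fact, no instance, no `sorry`); sequel of
`Sec4NonVacuityTowerConj.lean` (part 13: `negBase`, `conjFn`, `conj`, `thm44HypConj p`, `ψConj p`).  Proved here:

* `negBase_map_ne`, `conj_map_ne` — **`Ψ^bs ≠ 𝟭` and `Ψ ≠ 𝟭`**: `negBase` moves the deck transformation `1` of `X_3`
  (`-1 ≠ 1 (mod 3)`), `conj` moves "multiplication by `2`" on `A_⊙`;
* `transportBaseAut_shift`, `transportBaseAut_surjective` — the transport `Aut_D(A^bs) → Aut_D(Ψ(A)^bs)` of T44-L09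
  (abc-iut-L2-t3's `Thm44Hyp.transportBaseAut`) IS NEGATION on `ℤ/N`, a bijection;
* `hAbs_eq_top` — `H_A^bs = Aut_D(X_N)` for every object (`H_⊙ = Π^tp_X` and `Π^tp_X ↠ Aut_D(X_N)` is onto), so
  T44-L09c `GaloisCompatible` holds for `(Ψ, Ψ^bs)` with BOTH sides the full non-trivial group `ℤ/N`;
* `thm44HypConj_preservesFrobeniusStructure` (T44-L03: degrees/divisors untouched; Frobenius-type and pull-back
  morphisms re-certified by L1's `isCoAngular` / `isPullbackMorphism_of`), `thm44HypConj_biratCompatible` (T44-L10 for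
  `ψ := conjFn`: `conjFn_map` = "invert-the-constant commutes with pull-back up to negating the shift");
* `ToyTower.thm44_conj` — **Thm 4.4 (i)–(iv) FIRE** through `thm44_i_of_inputs`, `thm44_ii_of_subnodes`,
  `thm44_iii_of_inputs`, `thm44_iv_of_prop43_ii` — the FIRST `Thm44Hyp` inhabitant of the cell with `Ψ^bs ≠ 𝟭`
  (every earlier one — `Toy`, `ToyCov.thm44HypTwist` p431777, `ToyTower.thm44_id` — had `Ψ^bs = 𝟭`; over the
  collapsed base `Aut = 1` nothing else exists).

HONEST LIMITS: a toy (𝔾_m; trivial [FrdI] vocabularies; `(N,H)`-slot `True`; `c ↦ c⁻¹` stands in for `c ↦ c̄`);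
consistency ≠ faithfulness; typed ≠ proved.  Nothing here bears on, or takes a side on, [IUTchIII] Cor. 3.12.
-/

noncomputable section

namespace Literature.AnabelianGeometry.EtaleTheta

open CategoryTheory Opposite Literature.AlgebraicGeometry.Frobenioids
open scoped NNRat

namespace ToyTower

open Base

variable (p : ℕ) [Fact p.Prime]

/-! ## `Ψ^bs` and `Ψ` are not the identity -/

/-- **`Ψ^bs ≠ 𝟭`**: `negBase` moves the deck transformation `t_3 ↦ ζ_3 t_3` of `X_3` (`-1 ≠ 1` in `ℤ/3`).
[cite: MochizukiEtTh2009, Thm 4.4 p.93] -/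
theorem negBase_map_ne : ToyTower.negBase.map (shiftIso (⟨3⟩ : ToyTower.Base) 1).hom ≠ (shiftIso ⟨3⟩ 1).hom := by
  intro h
  have h1 : (-1 : ZMod ((⟨3⟩ : ToyTower.Base).lvl)) = 1 := congrArg Hom.shift h
  revert h1
  change (-1 : ZMod 3) = 1 → False
  decide

/-- **`Ψ ≠ 𝟭`**: `conj` moves the unit "multiplication by `2`" of `A_⊙` to "multiplication by `1/2`".
[cite: MochizukiEtTh2009, Thm 4.4 p.93] -/
theorem conj_map_ne :
    ToyTower.conj.map (ToyTower.coefAut ToyTower.Aodot (Units.mk0 (2 : ℂ) two_ne_zero)).hom ≠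
      (ToyTower.coefAut ToyTower.Aodot (Units.mk0 (2 : ℂ) two_ne_zero)).hom := by
  intro h
  have h1 := congrArg (fun φ : ToyTower.Aodot ⟶ ToyTower.Aodot =>
    ((ModelFrobenioid.unit φ : ToyTower.temperedFrobenioid.ratFnFunctor.obj (op ToyTower.Aodot.base)).1.1.1 : ℂˣ)) h
  change ((Units.mk0 (2 : ℂ) two_ne_zero)⁻¹ : ℂˣ) = Units.mk0 (2 : ℂ) two_ne_zero at h1
  have h2 := congrArg (fun u : ℂˣ => (u : ℂ)) h1
  norm_num [Units.val_inv_eq_inv_val] at h2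

/-! ## The transport of base automorphisms is negation on `ℤ/N` -/

/-- **`Aut_D(A^bs) → Aut_D(Ψ(A)^bs)` is NEGATION**: the transport of T44-L09 along `(Ψ, Ψ^bs)` sends the deck
transformation `a` to `-a`. [cite: MochizukiEtTh2009, Thm 4.4 p.94] -/
theorem transportBaseAut_shift (A : (ToyTower.biKummerSetting p).C) (σ : Aut ((ToyTower.biKummerSetting p).base.obj A)) :
    ((ToyTower.thm44HypConj p).transportBaseAut A σ).hom.shift = -σ.hom.shift := by
  rw [BiKummerSetting.Thm44Hyp.transportBaseAut_hom]
  exact conj_shift ((ToyTower.thm44HypConj p).cmp A) (ToyTower.negBase.map σ.hom)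

/-- The transport is onto (negation is a bijection of `ℤ/N`). [cite: MochizukiEtTh2009, Thm 4.4 p.94] -/
theorem transportBaseAut_surjective (A : (ToyTower.biKummerSetting p).C) :
    Function.Surjective ((ToyTower.thm44HypConj p).transportBaseAut A) := fun τ =>
  ⟨shiftIso _ (-τ.hom.shift), by
    rw [eq_shiftIso τ]
    exact Aut.ext (hom_ext (by rw [transportBaseAut_shift]; exact neg_neg _))⟩

/-- **`H_A^bs = Aut_D(X_N)`** for every object: `H_⊙ = Π^tp_X` (`hodot_eq_top`) and `Π^tp_X ↠ Aut_D(X_N)` is onto.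
[cite: MochizukiEtTh2009, Def 4.1 p.87] -/
theorem hAbs_eq_top (A : (ToyTower.biKummerSetting p).C) (hA : (ToyTower.biKummerSetting p).IsGalois A) :
    (ToyTower.biKummerSetting p).HAbs A hA = ⊤ := by
  change ((ToyTower.biKummerSetting p).Hodot).map _ = ⊤
  rw [hodot_eq_top, ← MonoidHom.range_eq_map, MonoidHom.range_eq_top]
  exact ToyTower.galoisSurj_surjective p A.base hA

/-- **T44-L09c `GaloisCompatible` for `(Ψ, Ψ^bs)`**: both sides are the full group `ℤ/N`, and the transport
(negation) is onto. [cite: MochizukiEtTh2009, Thm 4.4 p.94] -/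
theorem thm44HypConj_galoisCompatible : (ToyTower.thm44HypConj p).GaloisCompatible := fun A hA =>
  ⟨hA, by
    rw [hAbs_eq_top, hAbs_eq_top]
    refine eq_top_iff.2 fun τ _ => ?_
    obtain ⟨σ, hσ⟩ := transportBaseAut_surjective p A τ
    exact Subgroup.mem_map.2 ⟨σ, Subgroup.mem_top σ, hσ⟩⟩

/-! ## T44-L03 and T44-L10 for `(Ψ, ψ)` -/

/-- `Ψ` preserves base-isomorphisms (`negBase` is a functor). [cite: MochizukiEtTh2009, Thm 4.4 p.95] -/
theorem isBaseIso_conj_map {X Y : (ToyTower.biKummerSetting p).C} (φ : X ⟶ Y)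
    (h : PreFrobenioid.IsBaseIso (ToyTower.biKummerSetting p).F φ) :
    PreFrobenioid.IsBaseIso (ToyTower.biKummerSetting p).F ((ToyTower.thm44HypConj p).Ψ.functor.map φ) := by
  change IsIso (ToyTower.negBase.map (ModelFrobenioid.baseMap φ))
  haveI : IsIso (ModelFrobenioid.baseMap φ) := h
  infer_instance

/-- `Ψ` reflects base-isomorphisms (`negBase` is an involution). [cite: MochizukiEtTh2009, Thm 4.4 p.95] -/
theorem isBaseIso_of_conj_map {X Y : (ToyTower.biKummerSetting p).C} (φ : X ⟶ Y)
    (h : PreFrobenioid.IsBaseIso (ToyTower.biKummerSetting p).F ((ToyTower.thm44HypConj p).Ψ.functor.map φ)) :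
    PreFrobenioid.IsBaseIso (ToyTower.biKummerSetting p).F φ := by
  have h' : IsIso (ToyTower.negBase.map (ToyTower.negBase.map (ModelFrobenioid.baseMap φ))) := by
    haveI : IsIso (ToyTower.negBase.map (ModelFrobenioid.baseMap φ)) := h
    infer_instance
  rw [negBase_negBase_map] at h'
  exact h'

/-- **T44-L03 for `Ψ`**: degrees and divisors untouched; Frobenius-type / pull-back morphisms re-certified by L1's
`isCoAngular` / `isPullbackMorphism_of`. [cite: MochizukiEtTh2009, Thm 4.4 p.95] -/
theorem thm44HypConj_preservesFrobeniusStructure : (ToyTower.thm44HypConj p).PreservesFrobeniusStructure :=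
  ⟨fun _ _ _ => rfl, fun _ _ _ h => h,
    fun _ _ φ h => ⟨⟨ModelFrobenioid.isCoAngular ToyTower.ratFnFunctor_isGroupLike _, h.1.2⟩, isBaseIso_conj_map p φ h.2⟩,
    fun _ _ φ h => by
      obtain ⟨hn, hd⟩ := ModelFrobenioid.degFr_div_of_isPullbackMorphism ToyTower.divisorMonoid_isDivisorial h
      exact ModelFrobenioid.isPullbackMorphism_of ToyTower.divisorMonoid_isDivisorial ToyTower.ratFnFunctor_isGroupLike
        hn hd⟩

/-- **T44-L10 for `Ψ` and `ψ = conjFn`**: inverting the constant commutes with restriction along pre-steps (up to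
`Ψ^bs` on the base arrow), with the fractions `u_{s'} / u_{s''}` and with the `Aut`-action.
[cite: MochizukiEtTh2009, Thm 4.4 p.95] -/
theorem thm44HypConj_biratCompatible : (ToyTower.thm44HypConj p).BiratCompatible (ToyTower.ψConj p) := by
  refine ⟨fun {A B} s hs ks f => Units.ext ?_, fun {A B} s' s'' _ _ _ _ _ _ => ?_, fun {A} τ f => Units.ext ?_⟩
  · haveI : IsIso (ModelFrobenioid.baseMap s) := hs.2
    haveI : IsIso (ModelFrobenioid.baseMap ((ToyTower.thm44HypConj p).Ψ.functor.map s)) := ks.2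
    change ToyTower.conjFn _ ((ToyTower.temperedFrobenioid.ratFnFunctor.map (inv (ModelFrobenioid.baseMap s)).op).hom
        (Units.val f)) =
      (ToyTower.temperedFrobenioid.ratFnFunctor.map
        (inv (ModelFrobenioid.baseMap ((ToyTower.thm44HypConj p).Ψ.functor.map s))).op).hom
        (ToyTower.conjFn _ (Units.val f))
    rw [conjFn_map, Quiver.Hom.unop_op, Functor.map_inv]
    rfl
  · show ModelFrobenioid.unitU (ToyTower.temperedFrobenioid.isUnit_ratFnFunctor ToyTower.realified.isUnit_BΛ A)
          (ToyTower.conj.map s') /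
        ModelFrobenioid.unitU (ToyTower.temperedFrobenioid.isUnit_ratFnFunctor ToyTower.realified.isUnit_BΛ A)
          (ToyTower.conj.map s'') =
      Units.map (ToyTower.conjFn (op A.base))
        (ModelFrobenioid.unitU (ToyTower.temperedFrobenioid.isUnit_ratFnFunctor ToyTower.realified.isUnit_BΛ A) s' /
          ModelFrobenioid.unitU (ToyTower.temperedFrobenioid.isUnit_ratFnFunctor ToyTower.realified.isUnit_BΛ A) s'')
    rw [map_div]
    exact congrArg₂ (· / ·) (Units.ext rfl) (Units.ext rfl)
  · exact conjFn_map (ModelFrobenioid.baseMap τ.inv).op (Units.val f)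

/-! ## Thm 4.4 (i)–(iv) for `(Ψ, Ψ^bs)` -/

/-- **Thm 4.4 (i)–(iv) FIRE at the tower for the conjugation-type self-equivalence** `(Ψ, Ψ^bs) = (conj, negBase)`
with `ψ := conjFn` — the first `Thm44Hyp` of the cell with `Ψ^bs ≠ 𝟭`: T44-L03, T44-L09/L09c (transport =
negation on the NON-TRIVIAL `H_A^bs = ℤ/N`), T44-L10, T44-L12, T44-L15b, the reflected Frobenius-type clause and
"`C` is a Frobenioid" (integral exponents, p439630) — then `thm44_i_of_inputs`, `thm44_ii_of_subnodes`,
`thm44_iii_of_inputs`, `thm44_iv_of_prop43_ii`. [cite: MochizukiEtTh2009, Thm 4.4 p.94] -/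
theorem thm44_conj :
    ToyTower.negBase.map (shiftIso (⟨3⟩ : ToyTower.Base) 1).hom ≠ (shiftIso ⟨3⟩ 1).hom ∧
    BiKummerSetting.Thm44_i (ToyTower.thm44HypConj p) ∧
      BiKummerSetting.Thm44_ii (ToyTower.thm44HypConj p) (ToyTower.ψConj p) ∧
      BiKummerSetting.Thm44_iii (ToyTower.thm44HypConj p) (ToyTower.ψConj p) ∧
      BiKummerSetting.Thm44_iv (ToyTower.thm44HypConj p) (ToyTower.ψConj p)
        (fun {_ _} φ => ToyTower.temperedFrobenioid.pullFracModel φ)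
        (fun {_ _} φ => ToyTower.temperedFrobenioid.pullFracModel φ) := by
  have hHodot : (ToyTower.thm44HypConj p).HodotCompatible := ⟨ContinuousMulEquiv.refl _, Subgroup.map_id _⟩
  have hPDS : (ToyTower.thm44HypConj p).PreservesDisjointSupports := fun _ _ _ _ h => h
  have hPNH : (ToyTower.thm44HypConj p).PreservesNHSaturatedBsFld := fun _ _ _ _ _ => Iff.rfl
  exact ⟨negBase_map_ne,
    (ToyTower.thm44HypConj p).thm44_i_of_inputs ToyTower.temperedFrobenioid_isFrobenioid
      (thm44HypConj_preservesFrobeniusStructure p) (thm44HypConj_galoisCompatible p) hHodot,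
    (ToyTower.thm44HypConj p).thm44_ii_of_subnodes _ (thm44HypConj_preservesFrobeniusStructure p)
      (thm44HypConj_biratCompatible p) hPDS,
    (ToyTower.thm44HypConj p).thm44_iii_of_inputs _ (thm44HypConj_preservesFrobeniusStructure p)
      (fun _ _ φ h => ⟨⟨ModelFrobenioid.isCoAngular ToyTower.ratFnFunctor_isGroupLike φ, h.1.2⟩, isBaseIso_of_conj_map p φ h.2⟩)
      ToyTower.temperedFrobenioid_isFrobenioid hPNH,
    BiKummerSetting.thm44_iv_of_prop43_ii (ToyTower.thm44HypConj p) _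
      (fun {_ _} φ => ToyTower.temperedFrobenioid.pullFracModel φ)
      (fun {_ _} φ => ToyTower.temperedFrobenioid.pullFracModel φ) (ToyTower.prop43_ii p)⟩

end ToyTower

end Literature.AnabelianGeometry.EtaleTheta

end
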